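import Literature.MathematicalPhysics.QuantumFieldTheory.Balaban1983to89.B11Eq174ChartRegimesLipschitzAtFlatW80UnitaryClass
import Summits.QuantumFields.BalabanUV.T4Continuum.Support.NE9B11ChartAnalytic

/-!
# NE9CurChartTowerPiOneChartClassW80 — ONE `k`-LEVEL `cur U` CHART WITH THE GENUINE (L3) SLOT `W80` ON PRINT's UNITARY SMALL-FIELD CLASS: (Ψ1)–(Ψ3) AT `U`, (Ψ1)–(Ψ3) AT
# THE VACUUM, AND THE LIPSCHITZ MODULUS AT THE FLAT POINT — ALL FOR THE SAME CHART (same radii `ε₄, ε_C, R_b`), LATTICE-UNIFORMLY; cell `pub-balaban`, T4-DAG §2 node U3 ∕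
# §6 NE9, WALL-NE9-P1 §3 (ii)∕(vii); NE9 crux-team (2) LEAF PROVER 01 (`b2b-balaban-t4-ne9-formalise-leaf-01`, gen 106); bears_on R4/N22; nothing printed asserted

WHY THIS FILE.  The existence faces (`NE9CurChartTowerPiLatticeUniformClassW80VJDelta{,TopLevel}`: (Ψ1)–(Ψ3)) and the Lipschitz faces (`…LipschitzAtFlat…ClassW80{,TopLevel}`,
Lit `B11Eq174ChartLipschitzAtFlatW80LatticeFree`) each quantify the chart radii `(ε₄, ε_C)` on their own — the chart `chartHB 𝔊̃_k 0 W80 0 (A′ ↦ A′ + solA H̃_{1,k} 0 C_k 0 ε_C A′) ε₄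
H̃_{1,k}` DEPENDS on them, so the two families speak about two charts.  A `cur`-species consumer (`NE9CurveFromBackgroundMap`'s binders (Ψ1)–(Ψ3) AND the background
modulus of the SAME map) needs them jointly: this file delivers that, from this lineage's Lit package `B11Eq174ChartRegimesLipschitzAtFlatW80UnitaryClass` (gen 106; the
contraction regimes of Prop. 6 ∕ (44)–(47) at `U` and at the vacuum handed out next to the modulus) and the owner's `NE9B11ChartAnalytic.chartHB_triple_of_twoRegimes`
(`C_k` analytic: `B11Eq44CLetterTower.analyticOnNhd_Cck`; the slot analytic below `a_C`: `B11Eq80Current.analyticOnNhd_W80_lt`, Osgood).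

HONEST FRAMING (T4-DAG PAGE 1).  Rung (B)+1 of the FINITE-VOLUME T⁴ programme — NOT infinite volume, NOT a mass gap, NOT the Clay problem.  NE9 is a cell NEW
ESTIMATE, NOT PRINTED in [Balaban1987RG1] ∕ [Balaban1988RG2Cluster], NOT PROVED here («NE9 ⇐ the named binders»; spine PROVED 0∕9).  HONEST DEPENDENCY (cell
line, verbatim): continuum YM on T⁴ ⇐ BetaPertH ∧ nine spine estimates (0/9 proved); BetaPertH ⇐ (D1) ∧ (D4) ∧ CAP+tail; G-an2-4 gates asym, D1 and NE2/3/4.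
WHAT THIS FILE PROVES (ONE theorem; 0 def, 0 sorry; composition BY NAME).  **`cur_chart_tower_pi_one_chart_of_unitary_class_lattice_uniform_W80`**: `∃ α₁ j₁ ε₄ ε_C R_b R′ K
> 0` BEFORE `∀ n η m U` (print's class: `Ũ ∈ unitaryUnits 𝔸`, the bond ∕ all-direction ∕ plaquette ∕ gradient windows at `α ≤ α₁`, the current window `‖J‖ ≤ j₀ ≤ j₁`;
the diagonal bookkeeping; level maps with `n+1 ≤ lev₀` and profile bounds); `∃ h52 hpos′ hposπ hpos₁` PRODUCED; then for EVERY pair of maps `Φ_U, Φ_1` EQUAL to the chart at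
`U` (print's (3.122) letters at the geometric profile) and at the vacuum (the chain's letters): `Φ_U` is `DifferentiableOn ℂ` on `ball 0 R_b`, maps it into `ball 0 R′`,
`Φ_U 0 = 0`; the same for `Φ_1`; and `‖ι(Φ_U B) − Φ_1 B‖_(115),∇_1 ≤ K·(j₀ + α)` for `‖B‖ < R_b` (the chart terms written ONCE, as defining equations).
DISGUISE TEST: composition by name of landed theorems; no inequality of the series proved HERE; constants crude; `j₀`, `α` displayed separately; NOT the gauge step of p. 416,
NOT a general two-background pair, NOT claimed that Bałaban's 𝐇_k ∕ U_j(□₀, exp iB) meet these letters (O-NE9-1; #5 UNRULED); not NE9.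
References (TYPES ∕ loci only): [Balaban1985Variational] (27)–(28) p. 282, (44)–(47) p. 285, Prop. 4 (97)–(98) p. 293, Prop. 6 (116)–(121) p. 295, (174)–(175) p. 305,
Prop. 9 p. 309; [Balaban1985BackgroundPropagators] (3.35)–(3.37) p. 396, (3.122)–(3.126) p. 420, (3.153) p. 426, Thm 3.13 p. 426; [Balaban1985Averaging] Prop. 2 (52)–(54)
p. 26, Prop. 5 p. 42, Proposition 7 p. 43; [Balaban1987RG1] (3.37) p. 277, (3.53) p. 280.
-/

noncomputable section

open Metric Set

namespace Summit.QuantumFields.BalabanUV.T4Continuum.NE9CurChartTowerPiOneChartClassW80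

open scoped InnerProductSpace ComplexConjugate BigOperators
open Literature.MathematicalPhysics.QuantumFieldTheory.Balaban1983to89
open B11Eq103H1Complex B11Eq115Space B11Eq174Chart
open B11Eq111FrakG (nabla115 jetLinearEquiv)  open B13Contraction113 (QuadAnalytic)
open B9SectCLatticeCarrier (Bond bpos btgt shift unshift)  open B4Sect5Torus (TSite)
open B7Prop1Explicit (U1 Wcx boxVec)  open B7Prop2Explicit (pdev AvgClosed C0 c2' unitaryUnits avgClosed_unitaryUnits unitaryUnits_le_U1 avgIter_zero)
open B7Prop3Flat (c3)  open B7Prop5GeneralLevels (thetaGen C3Gen)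
open B7Prop5CplxLevels (epsCplx tauCplx C3Cplx)  open B9Eq315QTorus (perCfg cornerSite perSite perCfg_apply)
open B9Eq315QTower (towerP UlevOf)  open B9Eq315QTowerFlat (perCfg_UlevOf_one_mem_U1 norm_Wcx_UlevOf_one_sub_one_le UlevOf_one QkW_one_surjective)
open B9Eq326OperatorTower (QkW QkW_surjective laplaceAk RofUk)  open B9Eq310HessianOperator (adTransportW hessOp)
open B9Eq310DeltaPrime (plaqHolU plaqHolU_one)  open B9Eq324DeltaPrimeATower (laplacePrimeAk)
open B9Eq3119DeltaPiTower (laplaceAkPi)  open B11Eq44COperatorTower (αT αT_le ulev_mem_U1_of_pdev)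
open B11Eq44COperatorTowerGeometric (ulev_reg_of_pdev_geometric geomProfile_le_αT)  open B11Eq44CLetterTower (Cck prop4Hyp_Cck analyticOnNhd_Cck)
open B9Thm311SmallFieldClosed (hRS_of_unitary)  open B9Eq315QTorusOnto (liftSite perSite_liftSite)
open B7Eq43AveragedSmallnessLevelFree (pdev_perCfg_le_of_plaq)  open B7Eq43AveragedSmallnessLinearFeed (twoWindows_linear_feed)
open B9Thm311SitePrimeFormCoerciveTowerCanonical (exists_strong_site_coercive_tower_diagonal)
open B9Thm311LaplaceAkPiPositiveDiagonal (exists_laplaceAkPi_pos_diagonal_closed)  open B9Thm311LaplaceAkPositiveDiagonal (exists_laplaceAk_pos_diagonal_closed)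
open B9Eq326OperatorTowerRealityUnitary (UlevOf_star_eq_inv forall_star_eq_inv_of_mem)  open B9Eq342GreenPrimeSupBound (norm_adTransportW_eq)
open B9Eq3119DeltaPiCarrier (currentCLM)  open B11Eq98V0primeCurrentSlots (rieszτ rieszτ_apply)
open B11Eq98CurrentSlot (Jcur)  open B11Eq28JcurWindow (norm_Jcur_le_of_window levWeight_three_le)
open B11Eq80Current (W80 analyticOnNhd_W80_lt)
open B11Eq63V0GroupCurrent (curV0)  open B11Ineq88KernelLettersFlatChain (J_flat_le_zero)
open B11Eq174ChartRegimesLipschitzAtFlatW80UnitaryClass (exists_chartHB_W80_regimes_lipschitz_at_flat_unitaryClass)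
open Summit.QuantumFields.BalabanUV.T4Continuum.NE9B11ChartAnalytic (chartHB_triple_of_twoRegimes)

variable {d : ℕ} (hd : 1 ≤ d) (L : ℕ) [NeZero L] (hL : 1 ≤ L) (hL2 : 2 ≤ L) (hL3 : 3 ≤ L) [Fact (0 < (L : ℝ))]
  {𝔸 : Type*} [CStarAlgebra 𝔸] [Nontrivial 𝔸] [FiniteDimensional ℂ 𝔸]
  {W : Type*} [NormedAddCommGroup W] [InnerProductSpace ℂ W] [FiniteDimensional ℂ W] (φ : W ≃ₗ[ℂ] 𝔸)
  {Mφ Mφ' : ℝ} (hMφ : 0 ≤ Mφ) (hMφ' : 0 ≤ Mφ') (hφ : ∀ w, ‖φ w‖ ≤ Mφ * ‖w‖) (hφ' : ∀ X, ‖φ.symm X‖ ≤ Mφ' * ‖X‖)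
  {a : ℝ} (ha : 0 < a) {a' : ℝ} (ha' : 0 < a')
  (τ : 𝔸 →ₗ[ℂ] ℂ) {Cτ : ℝ} (hτ : ∀ X, ‖τ X‖ ≤ Cτ * ‖X‖) (hCτ : 0 ≤ Cτ) {Mτ : ℝ} (hτm : ∀ X Y : 𝔸, ‖τ (X * Y)‖ ≤ Mτ * ‖X‖ * ‖Y‖) (hMτ : 0 ≤ Mτ)
  {ρw : ℝ} (hρw : 0 ≤ ρw)
  (hτ₁ : ∀ X : 𝔸, τ (star X) = conj (τ X)) (hτ₂ : ∀ X Y : 𝔸, τ (X * Y) = τ (Y * X)) (hφτ : ∀ X Y : 𝔸, ⟪φ.symm X, φ.symm Y⟫_ℂ = τ (star X * Y))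
  {α₀ : ℝ} (hα₀ : 0 < α₀) (hα3 : C0 d * α₀ ≤ 1 / 3) (hα4 : 4 * α₀ ≤ c2' d L) (hα8 : 8 * α₀ ≤ c2' d L)
  (hαL : 50 * (d + 1) * αT d L α₀ * (L : ℝ) ^ d ≤ 1 / 2)
  {ρ : ℝ} (hρ0 : 0 < ρ) (hρ : Real.exp (4 * (800 * ((d : ℝ) + 1) ^ 2 * ((d : ℝ) + 4)) * α₀) * (1 + 8 * (131072 * ((d : ℝ) + 1) ^ 2) * ρ) ≤ 2)
  (hρ4 : 4 * ρ ≤ c3 d L) (hθ : 2 * d * thetaGen d L α₀ ≤ (L : ℝ) ^ 3 / 16) (hC3 : 2 * d * C3Gen d L * ρ ≤ 1)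
  (hCτ1 : Cτ ≤ 1) {ω Ω : ℝ} (hω1 : 1 ≤ ω) (hΩ1 : 1 ≤ Ω)
  {r' : ℝ} (hr' : 0 < r')
  (h7s' : Real.exp (4 * (800 * ((d : ℝ) + 1) ^ 2 * ((d : ℝ) + 4)) * α₀) * (1 + 8 * (131072 * ((d : ℝ) + 1) ^ 2) * r') ≤ 2)
  (h7c' : 2 * r' ≤ c3 d L) (h7r'1 : 409600 * ((d : ℝ) + 1) ^ 2 * r' ≤ 1)
  (h7s : Real.exp (4480 * ((d : ℝ) + 1) ^ 2 * ((d : ℝ) + 4) * α₀ + 240000 * ((d : ℝ) + 1) ^ 3 * r') * (1 + 8 * (2097152 * ((d : ℝ) + 1) ^ 2) * ρ) ≤ 2)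
  (h7c : 16 * ρ < c3 d L) (h7β : (d : ℝ) * C3Cplx d L * ρ ≤ 1)
  -- [B7] Prop. 5's complex numerics, HEIGHT-FREE (their values at `b′ := r′∕L^{n+1}`, `j = k = n+1` equal these)
  (h7E : epsCplx d L r' 0 ≤ 1 / 16) (h7dX : (d : ℝ) * (epsCplx d L r' 0 + tauCplx d L α₀ 0 r' 0) ≤ 1 / 16)

-- deep definitional unfolding `laplaceAkPi` ↦ `laplaceALatticeK … (π†Δπ) …` in the statement (as the host)
set_option maxRecDepth 8192 in
set_option maxHeartbeats 6400000 in -- the Lit package applied once + two chart triples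
include hd hL2 hL3 hMφ hMφ' hφ hφ' ha ha' hτ hCτ hτm hMτ hρw hτ₁ hτ₂ hφτ hα₀ hα3 hα4 hα8 hαL hρ0 hρ hρ4 hθ hC3 hCτ1 hω1 hΩ1 hr' h7s' h7c' h7r'1 h7s h7c h7β h7E h7dX in
/-- **ONE `k`-LEVEL `cur U` CHART WITH THE GENUINE SLOT ON PRINT's UNITARY CLASS: (Ψ1)–(Ψ3) AT `U`, (Ψ1)–(Ψ3) AT THE VACUUM, LIPSCHITZ AT THE FLAT POINT — SAME RADII,
LATTICE-UNIFORMLY** (statement via defining equations `Φ_U = chart_U`, `Φ_1 = chart_1`). [folklore]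
[cite: Balaban1985Variational, Prop. 6 (116)–(121) p.295, (174)–(175) p.305, Prop. 4 (97)–(98) pp.292–293, (44)–(47) p.285, Prop. 9 p.309; Balaban1985BackgroundPropagators, (3.35)–(3.37) p.396, (3.122) p.420, (3.153) p.426, Thm 3.13 p.426; Balaban1985Averaging, Prop. 2 (52)–(54) p.26, Proposition 7 p.43; Balaban1987RG1, (3.37) p.277, (3.53) p.280] -/
theorem cur_chart_tower_pi_one_chart_of_unitary_class_lattice_uniform_W80 :
    ∃ α₁ j₁ ε₄ εC Rb R' K : ℝ, 0 < α₁ ∧ 0 < j₁ ∧ 0 < ε₄ ∧ 0 < εC ∧ 0 < Rb ∧ 0 < R' ∧ 0 < K ∧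
      ∀ (n : ℕ) (η : ℝ) [Fact (0 < η)] (hηL : η * (L : ℝ) ^ (n + 1) = 1) (c₀ c₁ : ℝ) [Fact (0 < c₀)] [Fact (0 < c₁)]
        (_hw : c₀ * ((L : ℝ) ^ (n + 1)) ^ d = c₁) (_hc₀η : c₀ = η ^ d) (_hρ : |η| ^ d / c₀ ≤ ρw) (m : Fin d → ℕ) [∀ i, NeZero (m i)] (_hm : ∀ i, 1 ≤ m i)
        (U : Bond d (towerP L m (n + 1)) → 𝔸ˣ) (hUG : ∀ (x : B7Prop1Explicit.Site d) (κ : Fin d), perCfg (towerP L m (n + 1)) U x κ ∈ unitaryUnits 𝔸)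
        (α : ℝ) (_hα : 0 ≤ α) (_hαle : α ≤ α₁) (_hUη : ∀ b, ‖(U b : 𝔸) - 1‖ ≤ α * η)
        (_hUw : ∀ (x : TSite d (towerP L m (n + 1))) (μ ν : Fin d), ‖(U (shift ν x, μ) : 𝔸) - (U (x, μ) : 𝔸)‖ ≤ α * η ^ 2)
        (_hpl : ∀ p : B9SectCLatticeCarrier.Plaq d (towerP L m (n + 1)), ‖(plaqHolU U p : 𝔸) - 1‖ ≤ α * η ^ 2)
        (_hUgrad : ∀ (x : TSite d (towerP L m (n + 1))) (μ : Fin d), ‖(U (x, μ) : 𝔸) - U (unshift μ x, μ)‖ ≤ α * η ^ 2)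
        (j₀ : ℝ) (_hJ : ∀ μ y, ‖B9Eq39Adjoint.J (fun μ => B9Eq33CovDerivVector.shiftEquiv μ) (fun μ y => U (y, μ)) η μ y‖ ≤ j₀) (_hj : j₀ ≤ j₁)
        (lev₀ : Bond d (towerP L m (n + 1)) → ℕ) (lev₁ : Bond d (towerP L m (n + 1)) × Fin d → ℕ) (levB : Bond d m → ℕ) (_hlev : ∀ b, n + 1 ≤ lev₀ b)
        (_hw₀ : (NegSup.wSup (levWeight (L : ℝ) η lev₀ 1) : ℝ) ≤ ω) (_hw₁ : (NegSup.wSup (levWeight (L : ℝ) η lev₁ 2) : ℝ) ≤ ω)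
        (_hw₃ : (NegSup.wInvSup (levWeight (L : ℝ) η lev₀ 3) : ℝ) ≤ Ω) (_hwB : (NegSup.wInvSup (levWeight (L : ℝ) η levB 0) : ℝ) ≤ Ω)
        (_hw₁' : (NegSup.wInvSup (levWeight (L : ℝ) η lev₁ 2) : ℝ) ≤ Ω),
      ∃ h52 : pdev (perCfg (towerP L m (n + 1)) U) < α₀ * (((L : ℝ) ^ (n + 1))⁻¹) ^ 2,
      ∃ hpos' : ∀ x : SiteL2K ℂ d (towerP L m (n + 1)) c₀ W, x ≠ 0 →
          0 < RCLike.re ⟪x, laplacePrimeAk L m n φ η U a' (c₁ := c₁) x⟫_ℂ,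
      ∃ hposπ : ∀ x : BondL2K ℂ d (towerP L m (n + 1)) c₀ W, x ≠ 0 →
          0 < RCLike.re ⟪x, laplaceAkPi L m n φ τ η U a' hpos' hL (fun j => αT d L α₀ * (((L : ℝ) ^ min (j + 1) (n + 1))⁻¹) ^ 2)
            (fun j => (geomProfile_le_αT (d := d) L (n + 1) hL hα₀.le j).trans (αT_le hL hα4))
            (ulev_mem_U1_of_pdev L m (n + 1) U hL2 (avgClosed_unitaryUnits d L) hUG hα₀ hα3 hα4 h52)
            (ulev_reg_of_pdev_geometric L m (n + 1) U hL2 (avgClosed_unitaryUnits d L) hUG hα₀ hα3 hα4 h52) (c₁ := c₁) a x⟫_ℂ,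
      ∃ hpos₁ : ∀ x : BondL2K ℂ d (towerP L m (n + 1)) c₀ W, x ≠ 0 →
          0 < RCLike.re ⟪x, laplaceAk L m n φ η (fun _ : Bond d (towerP L m (n + 1)) => (1 : 𝔸ˣ)) hL (fun _ => 0) (fun _ => by norm_num)
            (perCfg_UlevOf_one_mem_U1 L m (n + 1)) (norm_Wcx_UlevOf_one_sub_one_le L m (n + 1) (fun _ => 0) (fun _ => le_rfl)) τ
            (c₀ := c₀) (c₁ := c₁) a x⟫_ℂ,
      ∀ (ΦU : NegSize (L : ℝ) η levB 0 𝔸 → Space115 (L : ℝ) η lev₀ lev₁ (nabla115 η U))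
        (Φ1 : NegSize (L : ℝ) η levB 0 𝔸 → Space115 (L : ℝ) η lev₀ lev₁ (nabla115 η (fun _ : Bond d (towerP L m (n + 1)) => (1 : 𝔸ˣ)))),
        ΦU =
          chartHB (frakGLatticeCLM (lev₀ := lev₀) φ hposπ
                (QkW_surjective L m n φ U hL _ _ _ _ fun j => le_trans (mul_le_mul_of_nonneg_right (mul_le_mul_of_nonneg_left
                  (geomProfile_le_αT (d := d) L (n + 1) hL hα₀.le j) (by positivity)) (by positivity)) hαL) lev₁ (nabla115 η U))
              0 (W80 (rieszτ φ) (LinearMap.toContinuousLinearMap τ) U (H1LatticeCLM (lev₀ := lev₀) (levB := levB) φ hposπ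
                (QkW_surjective L m n φ U hL _ _ _ _ fun j => le_trans (mul_le_mul_of_nonneg_right (mul_le_mul_of_nonneg_left
                  (geomProfile_le_αT (d := d) L (n + 1) hL hα₀.le j) (by positivity)) (by positivity)) hαL) lev₁ (nabla115 η U))
                (Cck L m η (n + 1) U lev₀ lev₁ (nabla115 η U) levB) εC (Jcur (L := (L : ℝ)) (η := η) (lev₀ := lev₀) U)
                (currentCLM φ lev₁ (nabla115 η U)
                  (laplaceAkPi L m n φ τ η U a' hpos' hL (fun j => αT d L α₀ * (((L : ℝ) ^ min (j + 1) (n + 1))⁻¹) ^ 2)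
                      (fun j => (geomProfile_le_αT (d := d) L (n + 1) hL hα₀.le j).trans (αT_le hL hα4))
                      (ulev_mem_U1_of_pdev L m (n + 1) U hL2 (avgClosed_unitaryUnits d L) hUG hα₀ hα3 hα4 h52)
                      (ulev_reg_of_pdev_geometric L m (n + 1) U hL2 (avgClosed_unitaryUnits d L) hUG hα₀ hα3 hα4 h52) (c₁ := c₁) a
                    - LinearMap.adjoint (QkW L m n φ U hL (fun j => αT d L α₀ * (((L : ℝ) ^ min (j + 1) (n + 1))⁻¹) ^ 2)
                      (fun j => (geomProfile_le_αT (d := d) L (n + 1) hL hα₀.le j).trans (αT_le hL hα4))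
                      (ulev_mem_U1_of_pdev L m (n + 1) U hL2 (avgClosed_unitaryUnits d L) hUG hα₀ hα3 hα4 h52)
                      (ulev_reg_of_pdev_geometric L m (n + 1) U hL2 (avgClosed_unitaryUnits d L) hUG hα₀ hα3 hα4 h52) (c₀ := c₀) (c₁ := c₁)) ∘ₗ
                        ((a : ℂ) • QkW L m n φ U hL (fun j => αT d L α₀ * (((L : ℝ) ^ min (j + 1) (n + 1))⁻¹) ^ 2)
                      (fun j => (geomProfile_le_αT (d := d) L (n + 1) hL hα₀.le j).trans (αT_le hL hα4))
                      (ulev_mem_U1_of_pdev L m (n + 1) U hL2 (avgClosed_unitaryUnits d L) hUG hα₀ hα3 hα4 h52)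
                      (ulev_reg_of_pdev_geometric L m (n + 1) U hL2 (avgClosed_unitaryUnits d L) hUG hα₀ hα3 hα4 h52) (c₀ := c₀) (c₁ := c₁))))) 0 (fun A' => A' + solA (H1LatticeCLM (lev₀ := lev₀) (levB := levB) φ hposπ
                (QkW_surjective L m n φ U hL _ _ _ _ fun j => le_trans (mul_le_mul_of_nonneg_right (mul_le_mul_of_nonneg_left
                  (geomProfile_le_αT (d := d) L (n + 1) hL hα₀.le j) (by positivity)) (by positivity)) hαL) lev₁ (nabla115 η U)) 0
                (Cck L m η (n + 1) U lev₀ lev₁ (nabla115 η U) levB) 0 εC A') ε₄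
              (H1LatticeCLM (lev₀ := lev₀) (levB := levB) φ hposπ
                (QkW_surjective L m n φ U hL _ _ _ _ fun j => le_trans (mul_le_mul_of_nonneg_right (mul_le_mul_of_nonneg_left
                  (geomProfile_le_αT (d := d) L (n + 1) hL hα₀.le j) (by positivity)) (by positivity)) hαL) lev₁ (nabla115 η U)) →
        Φ1 =
          chartHB (frakGLatticeCLM (L := (L : ℝ)) (η := η) (lev₀ := lev₀) (c := ((η : ℂ))⁻¹)
              (R := adTransportW φ (fun _ : Bond d (towerP L m (n + 1)) => (1 : 𝔸ˣ)))
              (S := adTransportW φ fun _ : Bond d (towerP L m (n + 1)) => (1 : 𝔸ˣ)⁻¹) (Δ₁ := hessOp φ η (fun _ : Bond d (towerP L m (n + 1)) => (1 : 𝔸ˣ)) τ)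
              (Rr := RofUk L m n φ η (fun _ : Bond d (towerP L m (n + 1)) => (1 : 𝔸ˣ)))
              (Q := (QkW L m n φ (fun _ : Bond d (towerP L m (n + 1)) => (1 : 𝔸ˣ)) hL (fun _ => 0) (fun _ => by norm_num)
                (perCfg_UlevOf_one_mem_U1 L m (n + 1)) (norm_Wcx_UlevOf_one_sub_one_le L m (n + 1) (fun _ => 0) (fun _ => le_rfl)) (c₀ := c₀) (c₁ := c₁))) (a := a)
              φ hpos₁ (QkW_one_surjective L m hL n φ) lev₁ (nabla115 η (fun _ : Bond d (towerP L m (n + 1)) => (1 : 𝔸ˣ)))) 0 (W80 (rieszτ φ) (LinearMap.toContinuousLinearMap τ) (fun _ : Bond d (towerP L m (n + 1)) => (1 : 𝔸ˣ))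
              (H1LatticeCLM (L := (L : ℝ)) (η := η) (lev₀ := lev₀) (levB := levB) (c := ((η : ℂ))⁻¹)
              (R := adTransportW φ (fun _ : Bond d (towerP L m (n + 1)) => (1 : 𝔸ˣ)))
              (S := adTransportW φ fun _ : Bond d (towerP L m (n + 1)) => (1 : 𝔸ˣ)⁻¹) (Δ₁ := hessOp φ η (fun _ : Bond d (towerP L m (n + 1)) => (1 : 𝔸ˣ)) τ)
              (Rr := RofUk L m n φ η (fun _ : Bond d (towerP L m (n + 1)) => (1 : 𝔸ˣ)))
              (Q := (QkW L m n φ (fun _ : Bond d (towerP L m (n + 1)) => (1 : 𝔸ˣ)) hL (fun _ => 0) (fun _ => by norm_num)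
                (perCfg_UlevOf_one_mem_U1 L m (n + 1)) (norm_Wcx_UlevOf_one_sub_one_le L m (n + 1) (fun _ => 0) (fun _ => le_rfl)) (c₀ := c₀) (c₁ := c₁))) (a := a)
              φ hpos₁ (QkW_one_surjective L m hL n φ) lev₁ (nabla115 η (fun _ : Bond d (towerP L m (n + 1)) => (1 : 𝔸ˣ))))
              (Cck L m η (n + 1) (fun _ : Bond d (towerP L m (n + 1)) => (1 : 𝔸ˣ)) lev₀ lev₁ (nabla115 η (fun _ : Bond d (towerP L m (n + 1)) => (1 : 𝔸ˣ))) levB) εC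
              (Jcur (L := (L : ℝ)) (η := η) (lev₀ := lev₀) (fun _ : Bond d (towerP L m (n + 1)) => (1 : 𝔸ˣ)))
              (currentCLM φ lev₁ (nabla115 η (fun _ : Bond d (towerP L m (n + 1)) => (1 : 𝔸ˣ)))
                (laplaceAk L m n φ η (fun _ : Bond d (towerP L m (n + 1)) => (1 : 𝔸ˣ)) hL (fun _ => 0) (fun _ => by norm_num)
                    (perCfg_UlevOf_one_mem_U1 L m (n + 1)) (norm_Wcx_UlevOf_one_sub_one_le L m (n + 1) (fun _ => 0) (fun _ => le_rfl)) τ (c₀ := c₀) (c₁ := c₁) a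
                  - LinearMap.adjoint (QkW L m n φ (fun _ : Bond d (towerP L m (n + 1)) => (1 : 𝔸ˣ)) hL (fun _ => 0) (fun _ => by norm_num)
                      (perCfg_UlevOf_one_mem_U1 L m (n + 1)) (norm_Wcx_UlevOf_one_sub_one_le L m (n + 1) (fun _ => 0) (fun _ => le_rfl)) (c₀ := c₀) (c₁ := c₁)) ∘ₗ
                      ((a : ℂ) • (QkW L m n φ (fun _ : Bond d (towerP L m (n + 1)) => (1 : 𝔸ˣ)) hL (fun _ => 0) (fun _ => by norm_num)
                        (perCfg_UlevOf_one_mem_U1 L m (n + 1)) (norm_Wcx_UlevOf_one_sub_one_le L m (n + 1) (fun _ => 0) (fun _ => le_rfl)) (c₀ := c₀) (c₁ := c₁)))))) 0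
            (fun A' => A' + solA (H1LatticeCLM (L := (L : ℝ)) (η := η) (lev₀ := lev₀) (levB := levB) (c := ((η : ℂ))⁻¹)
              (R := adTransportW φ (fun _ : Bond d (towerP L m (n + 1)) => (1 : 𝔸ˣ)))
              (S := adTransportW φ fun _ : Bond d (towerP L m (n + 1)) => (1 : 𝔸ˣ)⁻¹) (Δ₁ := hessOp φ η (fun _ : Bond d (towerP L m (n + 1)) => (1 : 𝔸ˣ)) τ)
              (Rr := RofUk L m n φ η (fun _ : Bond d (towerP L m (n + 1)) => (1 : 𝔸ˣ)))
              (Q := (QkW L m n φ (fun _ : Bond d (towerP L m (n + 1)) => (1 : 𝔸ˣ)) hL (fun _ => 0) (fun _ => by norm_num)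
                (perCfg_UlevOf_one_mem_U1 L m (n + 1)) (norm_Wcx_UlevOf_one_sub_one_le L m (n + 1) (fun _ => 0) (fun _ => le_rfl)) (c₀ := c₀) (c₁ := c₁))) (a := a)
              φ hpos₁ (QkW_one_surjective L m hL n φ) lev₁ (nabla115 η (fun _ : Bond d (towerP L m (n + 1)) => (1 : 𝔸ˣ)))) 0
              (Cck L m η (n + 1) (fun _ : Bond d (towerP L m (n + 1)) => (1 : 𝔸ˣ)) lev₀ lev₁ (nabla115 η (fun _ : Bond d (towerP L m (n + 1)) => (1 : 𝔸ˣ))) levB) 0 εC A') ε₄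
            (H1LatticeCLM (L := (L : ℝ)) (η := η) (lev₀ := lev₀) (levB := levB) (c := ((η : ℂ))⁻¹)
              (R := adTransportW φ (fun _ : Bond d (towerP L m (n + 1)) => (1 : 𝔸ˣ)))
              (S := adTransportW φ fun _ : Bond d (towerP L m (n + 1)) => (1 : 𝔸ˣ)⁻¹) (Δ₁ := hessOp φ η (fun _ : Bond d (towerP L m (n + 1)) => (1 : 𝔸ˣ)) τ)
              (Rr := RofUk L m n φ η (fun _ : Bond d (towerP L m (n + 1)) => (1 : 𝔸ˣ)))
              (Q := (QkW L m n φ (fun _ : Bond d (towerP L m (n + 1)) => (1 : 𝔸ˣ)) hL (fun _ => 0) (fun _ => by norm_num)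
                (perCfg_UlevOf_one_mem_U1 L m (n + 1)) (norm_Wcx_UlevOf_one_sub_one_le L m (n + 1) (fun _ => 0) (fun _ => le_rfl)) (c₀ := c₀) (c₁ := c₁))) (a := a)
              φ hpos₁ (QkW_one_surjective L m hL n φ) lev₁ (nabla115 η (fun _ : Bond d (towerP L m (n + 1)) => (1 : 𝔸ˣ)))) →
        (DifferentiableOn ℂ ΦU (ball (0 : NegSize (L : ℝ) η levB 0 𝔸) Rb) ∧ MapsTo ΦU (ball (0 : NegSize (L : ℝ) η levB 0 𝔸) Rb)
          (ball (0 : Space115 (L : ℝ) η lev₀ lev₁ (nabla115 η U)) R') ∧ ΦU 0 = 0) ∧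
        (DifferentiableOn ℂ Φ1 (ball (0 : NegSize (L : ℝ) η levB 0 𝔸) Rb) ∧ MapsTo Φ1 (ball (0 : NegSize (L : ℝ) η levB 0 𝔸) Rb)
          (ball (0 : Space115 (L : ℝ) η lev₀ lev₁ (nabla115 η (fun _ : Bond d (towerP L m (n + 1)) => (1 : 𝔸ˣ)))) R') ∧ Φ1 0 = 0) ∧
        ∀ (B : NegSize (L : ℝ) η levB 0 𝔸), ‖B‖ < Rb →
          ‖LinearMap.toContinuousLinearMap
              ((jetLinearEquiv (L : ℝ) η lev₀ lev₁ (nabla115 η (fun _ : Bond d (towerP L m (n + 1)) => (1 : 𝔸ˣ)))).symm.toLinearMap ∘ₗ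
                (jetLinearEquiv (L : ℝ) η lev₀ lev₁ (nabla115 η U)).toLinearMap) (ΦU B) - Φ1 B‖ ≤ K * (j₀ + α) := by
  obtain ⟨α₁, j₁, ε₄, εC, Rb, Rmap, K, hα₁, hj₁, hε₄, hεC, hRb, hRmap, hK, HC⟩ :=
    exists_chartHB_W80_regimes_lipschitz_at_flat_unitaryClass hd L hL hL2 hL3 φ hMφ hMφ' hφ hφ' ha ha' τ hτ hCτ hτm hMτ hρw hτ₁ hτ₂ hφτ hα₀ hα3 hα4 hα8 hαL hρ0 hρ
      hρ4 hθ hC3 hCτ1 hω1 hΩ1 hr' h7s' h7c' h7r'1 h7s h7c h7β h7E h7dX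
  refine ⟨α₁, j₁, ε₄, εC, Rb, Rmap, K, hα₁, hj₁, hε₄, hεC, hRb, hRmap, hK, ?_⟩
  intro n η _ hηL c₀ c₁ _ _ hw hc₀η hρ' m _ hm U hUG α hα0 hαle hUη hUw hpl hUgrad j₀ hJ hj' lev₀ lev₁ levB hlev hw₀ hw₁ hw₃ hwB hw₁'
  obtain ⟨h52, hpos', hposπ, hpos₁, CG, C₄, R'w, jr, ar, aC, hjr, har, hcap, hR'a, hRm, R₁, R₂, RC₁, RC₂, hBU, hB1, HL⟩ :=
    HC n η hηL c₀ c₁ hw hc₀η hρ' m hm U hUG α hα0 hαle hUη hUw hpl hUgrad j₀ hJ hj' lev₀ lev₁ levB hlev hw₀ hw₁ hw₃ hwB hw₁'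
  refine ⟨h52, hpos', hposπ, hpos₁, fun ΦU Φ1 hΦU hΦ1 => ?_⟩
  have hρc : 2 * ρ ≤ c3 d L := by linarith only [hρ4, hρ0]
  have hη0 : 0 < η := Fact.out
  -- `C_k` quadratic-analytic and analytic at `U` ((52) = `h52`) and at the vacuum; the genuine slot analytic below `a_C` (Osgood)
  have hUb1 : ∀ b' : Bond d (towerP L m (n + 1)), (fun _ : Bond d (towerP L m (n + 1)) => (1 : 𝔸ˣ)) b' ∈ U1 𝔸 := fun _ => one_mem _
  have hpl1 : ∀ p : B9SectCLatticeCarrier.Plaq d (towerP L m (n + 1)), ‖(plaqHolU (fun _ : Bond d (towerP L m (n + 1)) => (1 : 𝔸ˣ)) p : 𝔸) - 1‖ ≤ 0 * η ^ 2 :=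
    fun p => by rw [plaqHolU_one, Units.val_one, sub_self, norm_zero, zero_mul]
  have hUG1 : ∀ (x : B7Prop1Explicit.Site d) (κ : Fin d), perCfg (towerP L m (n + 1)) (fun _ : Bond d (towerP L m (n + 1)) => (1 : 𝔸ˣ)) x κ ∈ unitaryUnits 𝔸 :=
    fun x κ => by rw [perCfg_apply]; exact one_mem _
  have h52₁ : pdev (perCfg (towerP L m (n + 1)) (fun _ : Bond d (towerP L m (n + 1)) => (1 : 𝔸ˣ))) < α₀ * (((L : ℝ) ^ (n + 1))⁻¹) ^ 2 := by
    have hp := pdev_perCfg_le_of_plaq (U := fun _ : Bond d (towerP L m (n + 1)) => (1 : 𝔸ˣ)) hUb1 (by positivity : (0 : ℝ) ≤ 0 * η ^ 2) hpl1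
    rw [inv_eq_of_mul_eq_one_left hηL]
    exact lt_of_le_of_lt hp (mul_lt_mul_of_pos_right (by linarith) (by positivity))
  have hCa := analyticOnNhd_Cck L m η (n + 1) U lev₀ lev₁ (nabla115 η U) levB hL2 (avgClosed_unitaryUnits d L) hUG hα₀ hα3 hα4 h52 hlev hρ hρc
  have hCa1 := analyticOnNhd_Cck L m η (n + 1) (fun _ : Bond d (towerP L m (n + 1)) => (1 : 𝔸ˣ)) lev₀ lev₁
    (nabla115 η (fun _ : Bond d (towerP L m (n + 1)) => (1 : 𝔸ˣ))) levB hL2 (avgClosed_unitaryUnits d L) hUG1 hα₀ hα3 hα4 h52₁ hlev hρ hρc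
  have hCk := prop4Hyp_Cck L m η (n + 1) U lev₀ lev₁ (nabla115 η U) levB hL2 (avgClosed_unitaryUnits d L) hUG hα₀ hα3 hα4 h52 hlev hρ hρc
  have hCk1 := prop4Hyp_Cck L m η (n + 1) (fun _ : Bond d (towerP L m (n + 1)) => (1 : 𝔸ˣ)) lev₀ lev₁
    (nabla115 η (fun _ : Bond d (towerP L m (n + 1)) => (1 : 𝔸ˣ))) levB hL2 (avgClosed_unitaryUnits d L) hUG1 hα₀ hα3 hα4 h52₁ hlev hρ hρc
  have hT := chartHB_triple_of_twoRegimes R₁ (analyticOnNhd_W80_lt (rieszτ φ) (LinearMap.toContinuousLinearMap τ) U RC₁ hCk _ _ hR'a) hjr har RC₁ hCa hcap _ hBU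
    hRmap hRm
  have hT1 := chartHB_triple_of_twoRegimes R₂ (analyticOnNhd_W80_lt (rieszτ φ) (LinearMap.toContinuousLinearMap τ) (fun _ : Bond d (towerP L m (n + 1)) => (1 : 𝔸ˣ))
    RC₂ hCk1 _ _ hR'a) hjr har RC₂ hCa1 hcap _ hB1 hRmap hRm
  subst hΦU hΦ1
  exact ⟨hT, hT1, HL⟩

end Summit.QuantumFields.BalabanUV.T4Continuum.NE9CurChartTowerPiOneChartClassW80

end
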